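import Mathlib
import HarnessLib
import Summits.ValiantsHypothesis.ValiantsHypothesis.Theorems.LacunarySymmetroidMatrixDescartesOsculationLawCuspNonMonicCount
import Summits.ValiantsHypothesis.ValiantsHypothesis.Theorems.LacunarySymmetroidMatrixDescartesOsculationLawRankTwoColumnSupport
import Summits.ValiantsHypothesis.ValiantsHypothesis.Theorems.LacunarySymmetroidMatrixDescartesOsculationLawRankLetterSplitsAt
import Summits.ValiantsHypothesis.ValiantsHypothesis.Theorems.LacunarySymmetroidMatrixDescartesOsculationLawCuspCubicNonMonicCount
import Summits.ValiantsHypothesis.ValiantsHypothesis.Theorems.LacunarySymmetroidMatrixDescartesOsculationLawCuspCubicNonMonicSupportBound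
import Summits.ValiantsHypothesis.ValiantsHypothesis.Theorems.LacunarySymmetroidMatrixDescartesOsculationLawCuspCubicNonMonicSupport
import Summits.ValiantsHypothesis.ValiantsHypothesis.Theorems.LacunarySymmetroidMatrixDescartesOsculationLawCuspCubicNonMonicAlgebra
import Summits.ValiantsHypothesis.ValiantsHypothesis.Theorems.LacunarySymmetroidMatrixDescartesOsculationLawCuspCubicNonMonicReductionPoly

/-!
# ValiantsHypothesis / LacunarySymmetroid — crux `MatrixDescartes` (stmt-ValiantsHypothesis-18050, V1),
# line «osculation-law»: the RANK-FOUR column, DEGENERATE HALF (`a₄ = det G₂₂ ≡ 0`)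

For the splitting `(4, s)` the letter is the quartic `a₄b⁴ + a₃b³ + a₂b² + a₁b + a₀` of
`OsculationLetter.insertionPoly_rank_card` (`a₄ = det G₂₂`, `a₃, a₂, a₁` = sums of principal cofactors, `a₀ = det G`,
supports `s•E … (s+4)•E`).  This file settles the half where the top coefficient vanishes IDENTICALLY: the letter is
then the NON-MONIC CUBIC `a₃b³ + a₂b² + a₁b + a₀` (or quadratic / rank-one-shaped when `a₃ ≡ 0`, `a₃ ≡ a₂ ≡ 0`),
real-rooted at every `t` (the grouped letter splits at every abscissa, `OsculationLetter.splits_letter_at`; a splitting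
cubic with nonzero top coefficient factors, `cubic_factor_of_splits`), so val-lit-p6 g13's count
`OsculationCuspCubic.nonmonic_cubic_curve_ncard_le` (p613747) — with the staged reduction `hess_pseudo_reduce_poly3`
(p622429), `hessval_vertical`, `bound_le_pow_gen` at the shifted size `s + 1` — resp. `OsculationCuspGen.nonmonic_cusp_ncard_le`
(p609205) at size `s + 2`, resp. `OsculationRankOne.osc_ncard_le`, give

  `osc_four_s_of_top_zero (s K d S) (hS) (h4 : det G₂₂ ≡ 0) (hfin) : #osc ≤ 20 · K ^ (47 (s + 1) + 41)`.

The generic half (`a₄ ≢ 0`) needs a non-monic QUARTIC cusp count (not in the tree) and is not claimed here.  Honest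
framing: a located half-column of an UNREGISTERED V1 law line with a Descartes ceiling; `OsculationLaw` (all `m`),
`PeelInequality`, `stub_recursion`, `MatrixDescartes`, Conjecture B and `VP ≠ VNP` stay OPEN / NOT proved.  No
definitions, no named facts; Mathlib + tree osculation files only.
-/

-- `Summit.ValiantsHypothesis.ValiantsHypothesis.…` is the tree's mandated single-conjunct layout (Sub = Summit).
set_option linter.dupNamespace false

-- the cubic count and reduction carry explicit polynomials of ≈ 200 terms (deep terms)
set_option maxRecDepth 100000

noncomputable section

namespace Summit.ValiantsHypothesis.ValiantsHypothesis.Theorems.LacunarySymmetroidMatrixDescartes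

open Polynomial Set
open scoped BigOperators Pointwise

namespace OsculationRankFour

open OsculationCusp OsculationTwoK OsculationLetter OsculationRankTwo OsculationCuspCubic OsculationRankThree

/-- A splitting real cubic with nonzero top coefficient factors over `ℝ` (value form). [folklore] -/
theorem cubic_factor_of_splits (c₃ c₂ c₁ c₀ : ℝ) (hc : c₃ ≠ 0)
    (hs : (C c₃ * X ^ 3 + C c₂ * X ^ 2 + C c₁ * X + C c₀).Splits) :
    ∃ μ₁ μ₂ μ₃ : ℝ, ∀ b : ℝ, c₃ * b ^ 3 + c₂ * b ^ 2 + c₁ * b + c₀ = c₃ * ((b - μ₁) * (b - μ₂) * (b - μ₃)) := by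
  set f : ℝ[X] := C c₃ * X ^ 3 + C c₂ * X ^ 2 + C c₁ * X + C c₀ with hf
  have hdeg : f.natDegree = 3 := natDegree_cubic hc
  have hlc : f.leadingCoeff = c₃ := leadingCoeff_cubic hc
  have hcard : Multiset.card f.roots = 3 := by rw [← hdeg]; exact (splits_iff_card_roots.1 hs)
  obtain ⟨μ₁, μ₂, μ₃, hm⟩ := Multiset.card_eq_three.1 hcard
  refine ⟨μ₁, μ₂, μ₃, fun b => ?_⟩
  have hprod := hs.eq_prod_roots
  rw [hlc, hm] at hprod
  have := congrArg (Polynomial.eval b) hprod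
  rw [eval_mul, eval_C, eval_multiset_prod, Multiset.map_map] at this
  simp only [hf, eval_add, eval_mul, eval_C, eval_pow, eval_X, Function.comp_def, eval_sub,
    Multiset.insert_eq_cons, Multiset.map_cons, Multiset.map_singleton, Multiset.prod_cons,
    Multiset.prod_singleton] at this
  rw [this]; ring

/-- Power bookkeeping for the lower branches. [folklore] -/
theorem branch_arith4 (K s : ℕ) :
    5 * K ^ (15 * (s + 2) + 12) ≤ 20 * K ^ (47 * (s + 1) + 41) ∧ K ^ (4 * (s + 2) + 6) ≤ 20 * K ^ (47 * (s + 1) + 41) := by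
  have h1 := OsculationRankTwo.pow_le_pow_of_le' K (i := 15 * (s + 2) + 12) (j := 47 * (s + 1) + 41) (by omega) (by omega)
  have h2 := OsculationRankTwo.pow_le_pow_of_le' K (i := 4 * (s + 2) + 6) (j := 47 * (s + 1) + 41) (by omega) (by omega)
  constructor <;> omega

-- the proof instantiates the cubic/quadratic reductions and counts with explicit polynomials: slow elaboration.
set_option maxHeartbeats 3200000 in
/-- **Rank-four column, degenerate half.**  For every `s`, `K`, `d` and every symmetric block pencil
`S : Fin K → Matrix (Fin 4 ⊕ Fin s) (Fin 4 ⊕ Fin s) ℝ` with `det G₂₂ ≡ 0`: a finite osculation set of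
`det(Σ_l t^(d l) S_l + b·(I₄ ⊕ 0)) = 0` (the line's `osculationSet d S`, UNFOLDED verbatim) has at most
`20 · K^(47 (s + 1) + 41)` points. -/
theorem osc_four_s_of_top_zero (s K : ℕ) (d : Fin K → ℕ) (S : Fin K → Matrix (Fin 4 ⊕ Fin s) (Fin 4 ⊕ Fin s) ℝ)
    (hS : ∀ l, (S l).IsSymm) (h4 : (∑ l, (X : ℝ[X]) ^ d l • ((S l).toBlocks₂₂).map Polynomial.C).det = 0)
    (hfin : {p : Fin 2 → ℝ | 0 < p 0 ∧ 0 < p 1 ∧ MvPolynomial.eval p (∑ l, (MvPolynomial.X (0 : Fin 2) : MvPolynomial (Fin 2) ℝ) ^ d l •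
              (S l).map (MvPolynomial.C : ℝ →+* MvPolynomial (Fin 2) ℝ)
            + (MvPolynomial.X (1 : Fin 2) : MvPolynomial (Fin 2) ℝ) •
              (Matrix.fromBlocks 1 0 0 0 : Matrix (Fin 4 ⊕ Fin s) (Fin 4 ⊕ Fin s) ℝ).map
                (MvPolynomial.C : ℝ →+* MvPolynomial (Fin 2) ℝ)).det = 0 ∧
      MvPolynomial.eval p
        (MvPolynomial.X 0 * MvPolynomial.pderiv 0 (MvPolynomial.X 0 * MvPolynomial.pderiv 0 (∑ l, (MvPolynomial.X (0 : Fin 2) : MvPolynomial (Fin 2) ℝ) ^ d l •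
              (S l).map (MvPolynomial.C : ℝ →+* MvPolynomial (Fin 2) ℝ)
            + (MvPolynomial.X (1 : Fin 2) : MvPolynomial (Fin 2) ℝ) •
              (Matrix.fromBlocks 1 0 0 0 : Matrix (Fin 4 ⊕ Fin s) (Fin 4 ⊕ Fin s) ℝ).map
                (MvPolynomial.C : ℝ →+* MvPolynomial (Fin 2) ℝ)).det)
            * (MvPolynomial.X 1 * MvPolynomial.pderiv 1 (∑ l, (MvPolynomial.X (0 : Fin 2) : MvPolynomial (Fin 2) ℝ) ^ d l •
              (S l).map (MvPolynomial.C : ℝ →+* MvPolynomial (Fin 2) ℝ)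
            + (MvPolynomial.X (1 : Fin 2) : MvPolynomial (Fin 2) ℝ) •
              (Matrix.fromBlocks 1 0 0 0 : Matrix (Fin 4 ⊕ Fin s) (Fin 4 ⊕ Fin s) ℝ).map
                (MvPolynomial.C : ℝ →+* MvPolynomial (Fin 2) ℝ)).det) ^ 2
          - 2 * (MvPolynomial.X 0 * MvPolynomial.pderiv 0 (MvPolynomial.X 1 * MvPolynomial.pderiv 1 (∑ l, (MvPolynomial.X (0 : Fin 2) : MvPolynomial (Fin 2) ℝ) ^ d l •
              (S l).map (MvPolynomial.C : ℝ →+* MvPolynomial (Fin 2) ℝ)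
            + (MvPolynomial.X (1 : Fin 2) : MvPolynomial (Fin 2) ℝ) •
              (Matrix.fromBlocks 1 0 0 0 : Matrix (Fin 4 ⊕ Fin s) (Fin 4 ⊕ Fin s) ℝ).map
                (MvPolynomial.C : ℝ →+* MvPolynomial (Fin 2) ℝ)).det))
            * (MvPolynomial.X 0 * MvPolynomial.pderiv 0 (∑ l, (MvPolynomial.X (0 : Fin 2) : MvPolynomial (Fin 2) ℝ) ^ d l •
              (S l).map (MvPolynomial.C : ℝ →+* MvPolynomial (Fin 2) ℝ)
            + (MvPolynomial.X (1 : Fin 2) : MvPolynomial (Fin 2) ℝ) •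
              (Matrix.fromBlocks 1 0 0 0 : Matrix (Fin 4 ⊕ Fin s) (Fin 4 ⊕ Fin s) ℝ).map
                (MvPolynomial.C : ℝ →+* MvPolynomial (Fin 2) ℝ)).det) * (MvPolynomial.X 1 * MvPolynomial.pderiv 1 (∑ l, (MvPolynomial.X (0 : Fin 2) : MvPolynomial (Fin 2) ℝ) ^ d l •
              (S l).map (MvPolynomial.C : ℝ →+* MvPolynomial (Fin 2) ℝ)
            + (MvPolynomial.X (1 : Fin 2) : MvPolynomial (Fin 2) ℝ) •
              (Matrix.fromBlocks 1 0 0 0 : Matrix (Fin 4 ⊕ Fin s) (Fin 4 ⊕ Fin s) ℝ).map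
                (MvPolynomial.C : ℝ →+* MvPolynomial (Fin 2) ℝ)).det)
          + MvPolynomial.X 1 * MvPolynomial.pderiv 1 (MvPolynomial.X 1 * MvPolynomial.pderiv 1 (∑ l, (MvPolynomial.X (0 : Fin 2) : MvPolynomial (Fin 2) ℝ) ^ d l •
              (S l).map (MvPolynomial.C : ℝ →+* MvPolynomial (Fin 2) ℝ)
            + (MvPolynomial.X (1 : Fin 2) : MvPolynomial (Fin 2) ℝ) •
              (Matrix.fromBlocks 1 0 0 0 : Matrix (Fin 4 ⊕ Fin s) (Fin 4 ⊕ Fin s) ℝ).map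
                (MvPolynomial.C : ℝ →+* MvPolynomial (Fin 2) ℝ)).det)
            * (MvPolynomial.X 0 * MvPolynomial.pderiv 0 (∑ l, (MvPolynomial.X (0 : Fin 2) : MvPolynomial (Fin 2) ℝ) ^ d l •
              (S l).map (MvPolynomial.C : ℝ →+* MvPolynomial (Fin 2) ℝ)
            + (MvPolynomial.X (1 : Fin 2) : MvPolynomial (Fin 2) ℝ) •
              (Matrix.fromBlocks 1 0 0 0 : Matrix (Fin 4 ⊕ Fin s) (Fin 4 ⊕ Fin s) ℝ).map
                (MvPolynomial.C : ℝ →+* MvPolynomial (Fin 2) ℝ)).det) ^ 2) = 0}.Finite) :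
    {p : Fin 2 → ℝ | 0 < p 0 ∧ 0 < p 1 ∧ MvPolynomial.eval p (∑ l, (MvPolynomial.X (0 : Fin 2) : MvPolynomial (Fin 2) ℝ) ^ d l •
              (S l).map (MvPolynomial.C : ℝ →+* MvPolynomial (Fin 2) ℝ)
            + (MvPolynomial.X (1 : Fin 2) : MvPolynomial (Fin 2) ℝ) •
              (Matrix.fromBlocks 1 0 0 0 : Matrix (Fin 4 ⊕ Fin s) (Fin 4 ⊕ Fin s) ℝ).map
                (MvPolynomial.C : ℝ →+* MvPolynomial (Fin 2) ℝ)).det = 0 ∧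
      MvPolynomial.eval p
        (MvPolynomial.X 0 * MvPolynomial.pderiv 0 (MvPolynomial.X 0 * MvPolynomial.pderiv 0 (∑ l, (MvPolynomial.X (0 : Fin 2) : MvPolynomial (Fin 2) ℝ) ^ d l •
              (S l).map (MvPolynomial.C : ℝ →+* MvPolynomial (Fin 2) ℝ)
            + (MvPolynomial.X (1 : Fin 2) : MvPolynomial (Fin 2) ℝ) •
              (Matrix.fromBlocks 1 0 0 0 : Matrix (Fin 4 ⊕ Fin s) (Fin 4 ⊕ Fin s) ℝ).map
                (MvPolynomial.C : ℝ →+* MvPolynomial (Fin 2) ℝ)).det)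
            * (MvPolynomial.X 1 * MvPolynomial.pderiv 1 (∑ l, (MvPolynomial.X (0 : Fin 2) : MvPolynomial (Fin 2) ℝ) ^ d l •
              (S l).map (MvPolynomial.C : ℝ →+* MvPolynomial (Fin 2) ℝ)
            + (MvPolynomial.X (1 : Fin 2) : MvPolynomial (Fin 2) ℝ) •
              (Matrix.fromBlocks 1 0 0 0 : Matrix (Fin 4 ⊕ Fin s) (Fin 4 ⊕ Fin s) ℝ).map
                (MvPolynomial.C : ℝ →+* MvPolynomial (Fin 2) ℝ)).det) ^ 2
          - 2 * (MvPolynomial.X 0 * MvPolynomial.pderiv 0 (MvPolynomial.X 1 * MvPolynomial.pderiv 1 (∑ l, (MvPolynomial.X (0 : Fin 2) : MvPolynomial (Fin 2) ℝ) ^ d l •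
              (S l).map (MvPolynomial.C : ℝ →+* MvPolynomial (Fin 2) ℝ)
            + (MvPolynomial.X (1 : Fin 2) : MvPolynomial (Fin 2) ℝ) •
              (Matrix.fromBlocks 1 0 0 0 : Matrix (Fin 4 ⊕ Fin s) (Fin 4 ⊕ Fin s) ℝ).map
                (MvPolynomial.C : ℝ →+* MvPolynomial (Fin 2) ℝ)).det))
            * (MvPolynomial.X 0 * MvPolynomial.pderiv 0 (∑ l, (MvPolynomial.X (0 : Fin 2) : MvPolynomial (Fin 2) ℝ) ^ d l •
              (S l).map (MvPolynomial.C : ℝ →+* MvPolynomial (Fin 2) ℝ)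
            + (MvPolynomial.X (1 : Fin 2) : MvPolynomial (Fin 2) ℝ) •
              (Matrix.fromBlocks 1 0 0 0 : Matrix (Fin 4 ⊕ Fin s) (Fin 4 ⊕ Fin s) ℝ).map
                (MvPolynomial.C : ℝ →+* MvPolynomial (Fin 2) ℝ)).det) * (MvPolynomial.X 1 * MvPolynomial.pderiv 1 (∑ l, (MvPolynomial.X (0 : Fin 2) : MvPolynomial (Fin 2) ℝ) ^ d l •
              (S l).map (MvPolynomial.C : ℝ →+* MvPolynomial (Fin 2) ℝ)
            + (MvPolynomial.X (1 : Fin 2) : MvPolynomial (Fin 2) ℝ) •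
              (Matrix.fromBlocks 1 0 0 0 : Matrix (Fin 4 ⊕ Fin s) (Fin 4 ⊕ Fin s) ℝ).map
                (MvPolynomial.C : ℝ →+* MvPolynomial (Fin 2) ℝ)).det)
          + MvPolynomial.X 1 * MvPolynomial.pderiv 1 (MvPolynomial.X 1 * MvPolynomial.pderiv 1 (∑ l, (MvPolynomial.X (0 : Fin 2) : MvPolynomial (Fin 2) ℝ) ^ d l •
              (S l).map (MvPolynomial.C : ℝ →+* MvPolynomial (Fin 2) ℝ)
            + (MvPolynomial.X (1 : Fin 2) : MvPolynomial (Fin 2) ℝ) •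
              (Matrix.fromBlocks 1 0 0 0 : Matrix (Fin 4 ⊕ Fin s) (Fin 4 ⊕ Fin s) ℝ).map
                (MvPolynomial.C : ℝ →+* MvPolynomial (Fin 2) ℝ)).det)
            * (MvPolynomial.X 0 * MvPolynomial.pderiv 0 (∑ l, (MvPolynomial.X (0 : Fin 2) : MvPolynomial (Fin 2) ℝ) ^ d l •
              (S l).map (MvPolynomial.C : ℝ →+* MvPolynomial (Fin 2) ℝ)
            + (MvPolynomial.X (1 : Fin 2) : MvPolynomial (Fin 2) ℝ) •
              (Matrix.fromBlocks 1 0 0 0 : Matrix (Fin 4 ⊕ Fin s) (Fin 4 ⊕ Fin s) ℝ).map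
                (MvPolynomial.C : ℝ →+* MvPolynomial (Fin 2) ℝ)).det) ^ 2) = 0}.ncard ≤ 20 * K ^ (47 * (s + 1) + 41) := by

  classical
  have hEK : (Finset.univ.image d).card ≤ K := (Finset.card_image_le).trans (by simp)
  obtain ⟨hq, hro⟩ := branch_arith4 K s
  obtain ⟨h27, _⟩ := column_arith K (s + 2)
  -- the letter with vanishing top coefficient: the cubic `Φ = X₁³·ι a₃ + X₁²·ι a₂ + X₁·ι a₁ + ι(det G)`
  have hΦ : (∑ l, (MvPolynomial.X (0 : Fin 2) : MvPolynomial (Fin 2) ℝ) ^ d l •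
              (S l).map (MvPolynomial.C : ℝ →+* MvPolynomial (Fin 2) ℝ)
            + (MvPolynomial.X (1 : Fin 2) : MvPolynomial (Fin 2) ℝ) •
              (Matrix.fromBlocks 1 0 0 0 : Matrix (Fin 4 ⊕ Fin s) (Fin 4 ⊕ Fin s) ℝ).map
                (MvPolynomial.C : ℝ →+* MvPolynomial (Fin 2) ℝ)).det =
      MvPolynomial.X 1 * MvPolynomial.X 1 * MvPolynomial.X 1 * Polynomial.aeval (MvPolynomial.X 0 : MvPolynomial (Fin 2) ℝ)
          (∑ U ∈ (Finset.univ.map Function.Embedding.inl : Finset (Fin 4 ⊕ Fin s)).powersetCard 3,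
          (Matrix.of fun i j : Fin 4 ⊕ Fin s => if i ∈ U then (Pi.single i (1 : ℝ[X]) : Fin 4 ⊕ Fin s → ℝ[X]) j
            else (∑ l, (X : ℝ[X]) ^ d l • (S l).map Polynomial.C) i j).det)
        + MvPolynomial.X 1 * MvPolynomial.X 1 * Polynomial.aeval (MvPolynomial.X 0 : MvPolynomial (Fin 2) ℝ)
          (∑ U ∈ (Finset.univ.map Function.Embedding.inl : Finset (Fin 4 ⊕ Fin s)).powersetCard 2,
          (Matrix.of fun i j : Fin 4 ⊕ Fin s => if i ∈ U then (Pi.single i (1 : ℝ[X]) : Fin 4 ⊕ Fin s → ℝ[X]) j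
            else (∑ l, (X : ℝ[X]) ^ d l • (S l).map Polynomial.C) i j).det)
        + MvPolynomial.X 1 * Polynomial.aeval (MvPolynomial.X 0 : MvPolynomial (Fin 2) ℝ)
          (∑ U ∈ (Finset.univ.map Function.Embedding.inl : Finset (Fin 4 ⊕ Fin s)).powersetCard 1,
          (Matrix.of fun i j : Fin 4 ⊕ Fin s => if i ∈ U then (Pi.single i (1 : ℝ[X]) : Fin 4 ⊕ Fin s → ℝ[X]) j
            else (∑ l, (X : ℝ[X]) ^ d l • (S l).map Polynomial.C) i j).det)
        + Polynomial.aeval (MvPolynomial.X 0 : MvPolynomial (Fin 2) ℝ) (∑ l, (X : ℝ[X]) ^ d l • (S l).map Polynomial.C).det := by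
    rw [insertionPoly_rank_card 4 s d S, Finset.sum_range_succ, Finset.sum_range_succ, Finset.sum_range_succ,
      Finset.sum_range_succ, Finset.sum_range_succ, Finset.sum_range_zero, coeff_top 4 s d S, coeff_zero 4 s d S, h4, map_zero]
    ring
  -- supports (shifted size `s + 1`)
  have h3s : (∑ U ∈ (Finset.univ.map Function.Embedding.inl : Finset (Fin 4 ⊕ Fin s)).powersetCard 3,
          (Matrix.of fun i j : Fin 4 ⊕ Fin s => if i ∈ U then (Pi.single i (1 : ℝ[X]) : Fin 4 ⊕ Fin s → ℝ[X]) j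
            else (∑ l, (X : ℝ[X]) ^ d l • (S l).map Polynomial.C) i j).det).support ⊆ (s + 1) • Finset.univ.image d :=
    supp_cast (supp_coeff_card 4 s d S 3) (by omega)
  have h2s : (∑ U ∈ (Finset.univ.map Function.Embedding.inl : Finset (Fin 4 ⊕ Fin s)).powersetCard 2,
          (Matrix.of fun i j : Fin 4 ⊕ Fin s => if i ∈ U then (Pi.single i (1 : ℝ[X]) : Fin 4 ⊕ Fin s → ℝ[X]) j
            else (∑ l, (X : ℝ[X]) ^ d l • (S l).map Polynomial.C) i j).det).support ⊆ (s + 1 + 1) • Finset.univ.image d :=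
    supp_cast (supp_coeff_card 4 s d S 2) (by omega)
  have h1s : (∑ U ∈ (Finset.univ.map Function.Embedding.inl : Finset (Fin 4 ⊕ Fin s)).powersetCard 1,
          (Matrix.of fun i j : Fin 4 ⊕ Fin s => if i ∈ U then (Pi.single i (1 : ℝ[X]) : Fin 4 ⊕ Fin s → ℝ[X]) j
            else (∑ l, (X : ℝ[X]) ^ d l • (S l).map Polynomial.C) i j).det).support ⊆ (s + 1 + 2) • Finset.univ.image d :=
    supp_cast (supp_coeff_card 4 s d S 1) (by omega)
  have h0s : ((∑ l, (X : ℝ[X]) ^ d l • (S l).map Polynomial.C).det).support ⊆ (s + 1 + 3) • Finset.univ.image d :=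
    supp_cast (supp_det_pencil d S) (by simp [Fintype.card_sum, Fintype.card_fin]; omega)
  -- the letter splits at every abscissa; with `a₄ ≡ 0` it is the cubic
  have hsp : ∀ t : ℝ, (C (((∑ l, (X : ℝ[X]) ^ d l • (S l).map Polynomial.C).det).eval t) + X * C ((∑ U ∈ (Finset.univ.map Function.Embedding.inl : Finset (Fin 4 ⊕ Fin s)).powersetCard 1,
          (Matrix.of fun i j : Fin 4 ⊕ Fin s => if i ∈ U then (Pi.single i (1 : ℝ[X]) : Fin 4 ⊕ Fin s → ℝ[X]) j
            else (∑ l, (X : ℝ[X]) ^ d l • (S l).map Polynomial.C) i j).det).eval t)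
      + X ^ 2 * C ((∑ U ∈ (Finset.univ.map Function.Embedding.inl : Finset (Fin 4 ⊕ Fin s)).powersetCard 2,
          (Matrix.of fun i j : Fin 4 ⊕ Fin s => if i ∈ U then (Pi.single i (1 : ℝ[X]) : Fin 4 ⊕ Fin s → ℝ[X]) j
            else (∑ l, (X : ℝ[X]) ^ d l • (S l).map Polynomial.C) i j).det).eval t) + X ^ 3 * C ((∑ U ∈ (Finset.univ.map Function.Embedding.inl : Finset (Fin 4 ⊕ Fin s)).powersetCard 3,
          (Matrix.of fun i j : Fin 4 ⊕ Fin s => if i ∈ U then (Pi.single i (1 : ℝ[X]) : Fin 4 ⊕ Fin s → ℝ[X]) j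
            else (∑ l, (X : ℝ[X]) ^ d l • (S l).map Polynomial.C) i j).det).eval t)).Splits := by
    intro t
    have h := splits_letter_at 4 s d S hS t
    rw [Finset.sum_range_succ, Finset.sum_range_succ, Finset.sum_range_succ, Finset.sum_range_succ,
      Finset.sum_range_succ, Finset.sum_range_zero, zero_add, coeff_top 4 s d S, coeff_zero 4 s d S, h4, eval_zero,
      map_zero, mul_zero, add_zero, pow_zero, one_mul, pow_one] at h
    exact h
  by_cases h3 : (∑ U ∈ (Finset.univ.map Function.Embedding.inl : Finset (Fin 4 ⊕ Fin s)).powersetCard 3,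
          (Matrix.of fun i j : Fin 4 ⊕ Fin s => if i ∈ U then (Pi.single i (1 : ℝ[X]) : Fin 4 ⊕ Fin s → ℝ[X]) j
            else (∑ l, (X : ℝ[X]) ^ d l • (S l).map Polynomial.C) i j).det) = 0
  · -- the quadratic (or rank-one) letter
    have hΦ2 : (∑ l, (MvPolynomial.X (0 : Fin 2) : MvPolynomial (Fin 2) ℝ) ^ d l •
              (S l).map (MvPolynomial.C : ℝ →+* MvPolynomial (Fin 2) ℝ)
            + (MvPolynomial.X (1 : Fin 2) : MvPolynomial (Fin 2) ℝ) •
              (Matrix.fromBlocks 1 0 0 0 : Matrix (Fin 4 ⊕ Fin s) (Fin 4 ⊕ Fin s) ℝ).map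
                (MvPolynomial.C : ℝ →+* MvPolynomial (Fin 2) ℝ)).det =
        MvPolynomial.X 1 * MvPolynomial.X 1 * Polynomial.aeval (MvPolynomial.X 0 : MvPolynomial (Fin 2) ℝ)
            (∑ U ∈ (Finset.univ.map Function.Embedding.inl : Finset (Fin 4 ⊕ Fin s)).powersetCard 2,
          (Matrix.of fun i j : Fin 4 ⊕ Fin s => if i ∈ U then (Pi.single i (1 : ℝ[X]) : Fin 4 ⊕ Fin s → ℝ[X]) j
            else (∑ l, (X : ℝ[X]) ^ d l • (S l).map Polynomial.C) i j).det)
          + MvPolynomial.X 1 * Polynomial.aeval (MvPolynomial.X 0 : MvPolynomial (Fin 2) ℝ)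
            (∑ U ∈ (Finset.univ.map Function.Embedding.inl : Finset (Fin 4 ⊕ Fin s)).powersetCard 1,
          (Matrix.of fun i j : Fin 4 ⊕ Fin s => if i ∈ U then (Pi.single i (1 : ℝ[X]) : Fin 4 ⊕ Fin s → ℝ[X]) j
            else (∑ l, (X : ℝ[X]) ^ d l • (S l).map Polynomial.C) i j).det)
          + Polynomial.aeval (MvPolynomial.X 0 : MvPolynomial (Fin 2) ℝ) (∑ l, (X : ℝ[X]) ^ d l • (S l).map Polynomial.C).det := by
      rw [hΦ, h3, map_zero, mul_zero, zero_add]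
    have hdisc : ∀ t : ℝ, 4 * ((∑ U ∈ (Finset.univ.map Function.Embedding.inl : Finset (Fin 4 ⊕ Fin s)).powersetCard 2,
          (Matrix.of fun i j : Fin 4 ⊕ Fin s => if i ∈ U then (Pi.single i (1 : ℝ[X]) : Fin 4 ⊕ Fin s → ℝ[X]) j
            else (∑ l, (X : ℝ[X]) ^ d l • (S l).map Polynomial.C) i j).det).eval t * ((∑ l, (X : ℝ[X]) ^ d l • (S l).map Polynomial.C).det).eval t) ≤ (∑ U ∈ (Finset.univ.map Function.Embedding.inl : Finset (Fin 4 ⊕ Fin s)).powersetCard 1,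
          (Matrix.of fun i j : Fin 4 ⊕ Fin s => if i ∈ U then (Pi.single i (1 : ℝ[X]) : Fin 4 ⊕ Fin s → ℝ[X]) j
            else (∑ l, (X : ℝ[X]) ^ d l • (S l).map Polynomial.C) i j).det).eval t ^ 2 := by
      intro t
      have h := hsp t
      rw [h3, eval_zero, map_zero, mul_zero, add_zero] at h
      by_cases ha2 : (∑ U ∈ (Finset.univ.map Function.Embedding.inl : Finset (Fin 4 ⊕ Fin s)).powersetCard 2,
          (Matrix.of fun i j : Fin 4 ⊕ Fin s => if i ∈ U then (Pi.single i (1 : ℝ[X]) : Fin 4 ⊕ Fin s → ℝ[X]) j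
            else (∑ l, (X : ℝ[X]) ^ d l • (S l).map Polynomial.C) i j).det).eval t = 0
      · rw [ha2, zero_mul, mul_zero]; exact sq_nonneg _
      · refine discrim_nonneg_of_splits _ _ _ ha2 ?_
        convert h using 1
        ring
    by_cases h2 : (∑ U ∈ (Finset.univ.map Function.Embedding.inl : Finset (Fin 4 ⊕ Fin s)).powersetCard 2,
          (Matrix.of fun i j : Fin 4 ⊕ Fin s => if i ∈ U then (Pi.single i (1 : ℝ[X]) : Fin 4 ⊕ Fin s → ℝ[X]) j
            else (∑ l, (X : ℝ[X]) ^ d l • (S l).map Polynomial.C) i j).det) = 0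
    · have hΦ1 : (∑ l, (MvPolynomial.X (0 : Fin 2) : MvPolynomial (Fin 2) ℝ) ^ d l •
              (S l).map (MvPolynomial.C : ℝ →+* MvPolynomial (Fin 2) ℝ)
            + (MvPolynomial.X (1 : Fin 2) : MvPolynomial (Fin 2) ℝ) •
              (Matrix.fromBlocks 1 0 0 0 : Matrix (Fin 4 ⊕ Fin s) (Fin 4 ⊕ Fin s) ℝ).map
                (MvPolynomial.C : ℝ →+* MvPolynomial (Fin 2) ℝ)).det =
          Polynomial.aeval (MvPolynomial.X 0 : MvPolynomial (Fin 2) ℝ) (∑ l, (X : ℝ[X]) ^ d l • (S l).map Polynomial.C).det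
            + MvPolynomial.X 1 * Polynomial.aeval (MvPolynomial.X 0 : MvPolynomial (Fin 2) ℝ)
              (∑ U ∈ (Finset.univ.map Function.Embedding.inl : Finset (Fin 4 ⊕ Fin s)).powersetCard 1,
          (Matrix.of fun i j : Fin 4 ⊕ Fin s => if i ∈ U then (Pi.single i (1 : ℝ[X]) : Fin 4 ⊕ Fin s → ℝ[X]) j
            else (∑ l, (X : ℝ[X]) ^ d l • (S l).map Polynomial.C) i j).det) := by
        rw [hΦ2, h2, map_zero, mul_zero, zero_add, add_comm]
      refine (OsculationRankOne.osc_ncard_le _ _ _ hΦ1 hfin).trans ?_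
      refine (OsculationRankOne.card_roots_filter_pos_le_card_support _).trans ?_
      exact ((card_support_le_of_subset_nsmul (supp_R_gen _ _ _ (s + 2) (supp_cast h0s (by omega))
        (supp_cast h1s (by omega)))).trans (Nat.pow_le_pow_left hEK _)).trans hro
    · have h2s' : (∑ U ∈ (Finset.univ.map Function.Embedding.inl : Finset (Fin 4 ⊕ Fin s)).powersetCard 2,
          (Matrix.of fun i j : Fin 4 ⊕ Fin s => if i ∈ U then (Pi.single i (1 : ℝ[X]) : Fin 4 ⊕ Fin s → ℝ[X]) j
            else (∑ l, (X : ℝ[X]) ^ d l • (S l).map Polynomial.C) i j).det).support ⊆ (s + 2) • Finset.univ.image d := supp_cast h2s (by omega)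
      have h1s' : (∑ U ∈ (Finset.univ.map Function.Embedding.inl : Finset (Fin 4 ⊕ Fin s)).powersetCard 1,
          (Matrix.of fun i j : Fin 4 ⊕ Fin s => if i ∈ U then (Pi.single i (1 : ℝ[X]) : Fin 4 ⊕ Fin s → ℝ[X]) j
            else (∑ l, (X : ℝ[X]) ^ d l • (S l).map Polynomial.C) i j).det).support ⊆ (s + 2 + 1) • Finset.univ.image d := supp_cast h1s (by omega)
      have h0s' : ((∑ l, (X : ℝ[X]) ^ d l • (S l).map Polynomial.C).det).support ⊆ (s + 2 + 2) • Finset.univ.image d := supp_cast h0s (by omega)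
      have hcount := OsculationCuspGen.nonmonic_cusp_ncard_le _ _ _ _ _ _ hΦ2 h2 hdisc
        (fun t b hΨ => OsculationCuspGen.hess_reduce_poly _ _ _ _ _ t b _ _ _ _ _ _ _ _ _
          rfl rfl rfl rfl rfl rfl rfl rfl rfl rfl rfl hΨ) hfin
      have hN := (card_support_le_of_subset_nsmul (supp_N_gen _ _ _ _ (s + 2) h2s' h1s' h0s')).trans
        (Nat.pow_le_pow_left hEK _)
      have hU := (card_support_le_of_subset_nsmul (supp_U_gen _ _ _ _ (s + 2) h2s' h1s' h0s')).trans
        (Nat.pow_le_pow_left hEK _)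
      have hV := (card_support_le_of_subset_nsmul (supp_V_gen _ _ _ _ (s + 2) h2s' h1s' h0s')).trans
        (Nat.pow_le_pow_left hEK _)
      exact hcount.trans (((Nat.add_le_add (Nat.add_le_add hN (Nat.mul_le_mul_left 2 hU))
        (Nat.mul_le_mul_left 2 hV)).trans h27).trans hq)
  -- the cubic letter, `a₃ ≢ 0`: p6's non-monic cubic count
  have hreal : ∀ t : ℝ, (∑ U ∈ (Finset.univ.map Function.Embedding.inl : Finset (Fin 4 ⊕ Fin s)).powersetCard 3,
          (Matrix.of fun i j : Fin 4 ⊕ Fin s => if i ∈ U then (Pi.single i (1 : ℝ[X]) : Fin 4 ⊕ Fin s → ℝ[X]) j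
            else (∑ l, (X : ℝ[X]) ^ d l • (S l).map Polynomial.C) i j).det).eval t ≠ 0 → ∃ μ₁ μ₂ μ₃ : ℝ, ∀ b : ℝ,
      (∑ U ∈ (Finset.univ.map Function.Embedding.inl : Finset (Fin 4 ⊕ Fin s)).powersetCard 3,
          (Matrix.of fun i j : Fin 4 ⊕ Fin s => if i ∈ U then (Pi.single i (1 : ℝ[X]) : Fin 4 ⊕ Fin s → ℝ[X]) j
            else (∑ l, (X : ℝ[X]) ^ d l • (S l).map Polynomial.C) i j).det).eval t * b ^ 3 + (∑ U ∈ (Finset.univ.map Function.Embedding.inl : Finset (Fin 4 ⊕ Fin s)).powersetCard 2,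
          (Matrix.of fun i j : Fin 4 ⊕ Fin s => if i ∈ U then (Pi.single i (1 : ℝ[X]) : Fin 4 ⊕ Fin s → ℝ[X]) j
            else (∑ l, (X : ℝ[X]) ^ d l • (S l).map Polynomial.C) i j).det).eval t * b ^ 2
        + (∑ U ∈ (Finset.univ.map Function.Embedding.inl : Finset (Fin 4 ⊕ Fin s)).powersetCard 1,
          (Matrix.of fun i j : Fin 4 ⊕ Fin s => if i ∈ U then (Pi.single i (1 : ℝ[X]) : Fin 4 ⊕ Fin s → ℝ[X]) j
            else (∑ l, (X : ℝ[X]) ^ d l • (S l).map Polynomial.C) i j).det).eval t * b + ((∑ l, (X : ℝ[X]) ^ d l • (S l).map Polynomial.C).det).eval t =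
      (∑ U ∈ (Finset.univ.map Function.Embedding.inl : Finset (Fin 4 ⊕ Fin s)).powersetCard 3,
          (Matrix.of fun i j : Fin 4 ⊕ Fin s => if i ∈ U then (Pi.single i (1 : ℝ[X]) : Fin 4 ⊕ Fin s → ℝ[X]) j
            else (∑ l, (X : ℝ[X]) ^ d l • (S l).map Polynomial.C) i j).det).eval t * ((b - μ₁) * (b - μ₂) * (b - μ₃)) := by
    intro t ht
    have h := hsp t
    have h' : (C ((∑ U ∈ (Finset.univ.map Function.Embedding.inl : Finset (Fin 4 ⊕ Fin s)).powersetCard 3,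
          (Matrix.of fun i j : Fin 4 ⊕ Fin s => if i ∈ U then (Pi.single i (1 : ℝ[X]) : Fin 4 ⊕ Fin s → ℝ[X]) j
            else (∑ l, (X : ℝ[X]) ^ d l • (S l).map Polynomial.C) i j).det).eval t) * X ^ 3 + C ((∑ U ∈ (Finset.univ.map Function.Embedding.inl : Finset (Fin 4 ⊕ Fin s)).powersetCard 2,
          (Matrix.of fun i j : Fin 4 ⊕ Fin s => if i ∈ U then (Pi.single i (1 : ℝ[X]) : Fin 4 ⊕ Fin s → ℝ[X]) j
            else (∑ l, (X : ℝ[X]) ^ d l • (S l).map Polynomial.C) i j).det).eval t) * X ^ 2 + C ((∑ U ∈ (Finset.univ.map Function.Embedding.inl : Finset (Fin 4 ⊕ Fin s)).powersetCard 1,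
          (Matrix.of fun i j : Fin 4 ⊕ Fin s => if i ∈ U then (Pi.single i (1 : ℝ[X]) : Fin 4 ⊕ Fin s → ℝ[X]) j
            else (∑ l, (X : ℝ[X]) ^ d l • (S l).map Polynomial.C) i j).det).eval t) * X
        + C (((∑ l, (X : ℝ[X]) ^ d l • (S l).map Polynomial.C).det).eval t)).Splits := by
      convert h using 1
      ring
    exact cubic_factor_of_splits _ _ _ _ ht h'
  refine (nonmonic_cubic_curve_ncard_le _ _ _ _ _ _ _ _ h3
    (fun p hp => by
      obtain ⟨h0, h1, hΦ0, hH0⟩ := hp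
      rw [hΦ, eval_Psi3] at hΦ0
      rw [eval_logHessian_Psi3 _ _ _ _ _ hΦ] at hH0
      have hred := hess_pseudo_reduce_poly3 _ _ _ _ (p 0) (p 1) hΦ0
      rw [hH0, mul_zero] at hred
      exact ⟨h0, h1, hΦ0, hred.symm⟩)
    (fun t b ht hb ha3 hΨ0 hR => by
      refine ⟨by simpa using ht, by simpa using hb, ?_, ?_⟩
      · rw [hΦ, eval_Psi3]
        simp only [Matrix.cons_val_zero, Matrix.cons_val_one]
        exact hΨ0
      · rw [eval_logHessian_Psi3 _ _ _ _ _ hΦ]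
        simp only [Matrix.cons_val_zero, Matrix.cons_val_one]
        have hred := hess_pseudo_reduce_poly3 _ _ _ _ t b hΨ0
        rw [hR] at hred
        exact (mul_eq_zero.1 hred).resolve_left (pow_ne_zero 6 ha3))
    (fun t ht e3 e2 e1 e0 b hb => by
      refine ⟨by simpa using ht, by simpa using hb, ?_, ?_⟩
      · rw [hΦ, eval_Psi3]
        simp only [Matrix.cons_val_zero, Matrix.cons_val_one, e3, e2, e1, e0]
        ring
      · rw [eval_logHessian_Psi3 _ _ _ _ _ hΦ]
        simp only [Matrix.cons_val_zero, Matrix.cons_val_one]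
        exact hessval_vertical _ _ _ _ t b e3 e2 e1)
    hreal hfin).trans ?_
  exact bound_le_pow_gen (s := s + 1) (by omega) hEK h3s h2s h1s h0s (supp_R2n _ _ _ _ _ (s + 1) h3s h2s h1s h0s)
    (supp_R1n _ _ _ _ _ (s + 1) h3s h2s h1s h0s) (supp_R0n _ _ _ _ _ (s + 1) h3s h2s h1s h0s)

end OsculationRankFour

end Summit.ValiantsHypothesis.ValiantsHypothesis.Theorems.LacunarySymmetroidMatrixDescartes
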